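import Literature.AlgebraicGeometry.HodgeTheory.LefschetzDecompositionPolarizationForm
import HarnessLib

/-!
# The polarization form of the Lefschetz decomposition under maps BETWEEN TWO SPACES commuting with `L`
# (flatness of the polarization of a family up to the scalar of the traces)

Family `hodge`, layer `Literature/AlgebraicGeometry/HodgeTheory`; proof file (theorems only, no
definition, no named fact). Written by the prover seat `hodge-nonav-prover-Ax` (g11, cell `hodge-nonav`)
for the programme «GRIFFITHS-SURFACES» (route `HodgeConjecture/CyclicUnitaryPowers`), brick B5b.

`LefschetzDecompositionPolarizationForm.polarizationForm_map_of_commute` treats a family of additive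
ENDOMORPHISMS of `H•(Y; R)` commuting with the Lefschetz operator (the monodromy of a loop, consumer
`PolarizationFormMonodromyInvariant.polarizationForm_transportFun`). The parallel transport of a family
along a path from `s` to `t` is a family of additive maps `φ_a : Hᵃ(Y; R) → Hᵃ(Y'; R)` between the
cohomologies of TWO fibres, intertwining `L_κ` and `L_{κ'}` for the restrictions `κ`, `κ'` of a global
class (`transportFun_lefschetzOperator`), multiplicative (`transportFun_cupProduct`), and carrying the line
`H²ⁿ(Y)` onto the line `H²ⁿ(Y')`, so that any two "traces" satisfy `τ' ∘ φ = c · τ`. This file proves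
the corresponding two-space statements, ending with
**`polarizationForm_map₂`: `Q_{κ',τ'}(φ x, φ y) = c · Q_{κ,τ}(x, y)`** — the polarization forms of the
fibres of a family are flat up to the scalar relating the traces (Voisin I §7.1.2 / §9.2.1, "the
intersection form is flat"; Voisin II §3.1.2).

* `map_lefschetzPowTo₂`, `map_mem_primitiveClasses₂`, `map_mem_lefschetzSummand₂` — `φ` intertwines
  the iterates `Lᵗ`, preserves primitive classes and Lefschetz summands;
* `map_internalProj_lefschetzSummand₂`, `map_primitivePart₂` — `φ` commutes with the Lefschetz
  projections and the primitive parts (uniqueness of the Lefschetz decomposition on `Y'`);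
* `polarizationForm_map₂` — the statement above.

## References

* [VoisinHodgeI2002] C. Voisin, Hodge Theory and Complex Algebraic Geometry I, CUP 2002, §6.2.3
  Cor. 6.26, §6.3.2, §7.1.2, §9.2.1.
* [VoisinHodgeII2003] C. Voisin, Hodge Theory and Complex Algebraic Geometry II, CUP 2003, §3.1.2.
-/

noncomputable section

open CategoryTheory AlgebraicGeometry

universe u v

namespace Literature.AlgebraicGeometry.HodgeTheory

section HodgeTheory

open Literature.AlgebraicTopology.SingularHomology Literature.Geometry.Kaehler

section TwoSpaces

variable {Y Y' : Type u} [TopologicalSpace Y] [TopologicalSpace Y'] {R : Type v} [CommRing R]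
  {κ : singularCohomology R R Y 2} {κ' : singularCohomology R R Y' 2} {n : ℕ}
  (φ : ∀ a, singularCohomology R R Y a →+ singularCohomology R R Y' a)
  (hφ : ∀ (k l : ℕ) (h : 2 + k = l) (x : singularCohomology R R Y k),
    φ l (lefschetzOperator κ h x) = lefschetzOperator κ' h (φ k x))

include hφ in
/-- A family of additive maps intertwining `L_κ` and `L_{κ'}` intertwines their iterates:
`φ (Lᵗ_κ x) = Lᵗ_{κ'} (φ x)`. [cite: VoisinHodgeI2002, §6.2.3] -/
theorem map_lefschetzPowTo₂ :
    ∀ (t a m : ℕ) (h : a + 2 * t = m) (x : singularCohomology R R Y a),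
      φ m (lefschetzPowTo κ t a m h x) = lefschetzPowTo κ' t a m h (φ a x)
  | 0, a, m, h, x => by
    subst h
    rfl
  | t + 1, a, m, h, x => by
    rw [lefschetzPowTo_succ_apply κ t a (a + 2 * t) m rfl h (by omega),
      lefschetzPowTo_succ_apply κ' t a (a + 2 * t) m rfl h (by omega), hφ,
      map_lefschetzPowTo₂ t a (a + 2 * t) rfl x]

include hφ in
/-- Such a family maps primitive classes for `κ` to primitive classes for `κ'`.
[cite: VoisinHodgeI2002, §6.2.3 Def. 6.24] -/
theorem map_mem_primitiveClasses₂ {a : ℕ} {x : singularCohomology R R Y a}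
    (hx : x ∈ primitiveClasses κ n a) : φ a x ∈ primitiveClasses κ' n a :=
  ⟨fun ha ↦ by rw [hx.1 ha, map_zero],
    fun r m h hr ↦ by rw [← map_lefschetzPowTo₂ φ hφ r a m h x, hx.2 r m h hr, map_zero]⟩

include hφ in
/-- Such a family maps the summand `Lᵗ Pᵃ` for `κ` into the summand `Lᵗ Pᵃ` for `κ'`.
[cite: VoisinHodgeI2002, §6.2.3 Cor. 6.26] -/
theorem map_mem_lefschetzSummand₂ {i : ℕ} (p : {p : ℕ × ℕ // p.1 + 2 * p.2 = i})
    {x : singularCohomology R R Y i} (hx : x ∈ lefschetzSummand κ n i p) :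
    φ i x ∈ lefschetzSummand κ' n i p := by
  obtain ⟨x', hx', rfl⟩ := (mem_lefschetzSummand_iff p x).1 hx
  rw [map_lefschetzPowTo₂ φ hφ]
  exact lefschetzPowTo_mem_lefschetzSummand p.2 (map_mem_primitiveClasses₂ φ hφ hx')

variable (hL : HasHardLefschetzProperty κ n)
  (hvan : ∀ m, 2 * n < m → Subsingleton (singularCohomology R R Y m))
  (hL' : HasHardLefschetzProperty κ' n)
  (hvan' : ∀ m, 2 * n < m → Subsingleton (singularCohomology R R Y' m))

include hφ in
/-- **Such a family commutes with the Lefschetz projections** (both `κ` and `κ'` having the hard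
Lefschetz property): the components of `φ x` are the `φ` of the components of `x` (uniqueness of the
Lefschetz decomposition on `Y'`). [cite: VoisinHodgeI2002, §6.2.3 Cor. 6.26] -/
theorem map_internalProj_lefschetzSummand₂ {i : ℕ} (p : {p : ℕ × ℕ // p.1 + 2 * p.2 = i})
    (x : singularCohomology R R Y i) :
    φ i (internalProj (isInternal_lefschetzSummand κ n hL hvan i) p x) =
      internalProj (isInternal_lefschetzSummand κ' n hL' hvan' i) p (φ i x) := by
  classical
  symm
  refine internalProj_eq_of_sum_eq _
    (y := fun q ↦ φ i (internalProj (isInternal_lefschetzSummand κ n hL hvan i) q x))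
    (fun q ↦ map_mem_lefschetzSummand₂ φ hφ q (internalProj_mem _ q x)) ?_ p
  rw [← map_sum, sum_internalProj]

include hφ in
/-- **Such a family commutes with the primitive parts**: `φ (ξ_p x) = ξ'_p (φ x)`.
[cite: VoisinHodgeI2002, §6.2.3 Cor. 6.26] -/
theorem map_primitivePart₂ {i : ℕ} (p : {p : ℕ × ℕ // p.1 + 2 * p.2 = i})
    (x : singularCohomology R R Y i) :
    φ p.1.1 (primitivePart κ n hL hvan p x) = primitivePart κ' n hL' hvan' p (φ i x) := by
  rcases le_or_gt (p.1.1 + p.1.2) n with hp | hp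
  · apply injective_lefschetzPowTo_of_le κ' n hL' hp p.2
    rw [← map_lefschetzPowTo₂ φ hφ, lefschetzPowTo_primitivePart hL hvan p hp,
      lefschetzPowTo_primitivePart hL' hvan' p hp,
      map_internalProj_lefschetzSummand₂ φ hφ hL hvan hL' hvan']
  · rw [primitivePart_of_lt hL hvan p hp, primitivePart_of_lt hL' hvan' p hp, LinearMap.zero_apply,
      LinearMap.zero_apply, map_zero]

include hφ in
/-- **The polarization form under a multiplicative family of maps between two spaces commuting with
`L` and scaling the traces: `Q_{κ',τ'}(φ x, φ y) = c · Q_{κ,τ}(x, y)`** — for the parallel transport of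
a smooth projective family between two fibres (with the restrictions of a global Kähler class and any
traces on the top cohomology lines, `τ' ∘ φ = c · τ`) this is the FLATNESS of the polarization up to
the scalar `c`. [cite: VoisinHodgeI2002, §7.1.2 and §9.2.1] [cite: VoisinHodgeII2003, §3.1.2] -/
theorem polarizationForm_map₂ (τ : singularCohomology R R Y (2 * n) →ₗ[R] R)
    (τ' : singularCohomology R R Y' (2 * n) →ₗ[R] R) (c : R)
    (hcup : ∀ (p q r : ℕ) (h : p + q = r) (x : singularCohomology R R Y p)
      (y : singularCohomology R R Y q), φ r (cupProduct h x y) = cupProduct h (φ p x) (φ q y))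
    (hτ : ∀ z, τ' (φ (2 * n) z) = c * τ z) {i : ℕ} (x y : singularCohomology R R Y i) :
    polarizationForm κ' n hL' hvan' τ' i (φ i x) (φ i y) = c * polarizationForm κ n hL hvan τ i x y := by
  rw [polarizationForm_apply, polarizationForm_apply, Finset.mul_sum]
  refine Finset.sum_congr rfl fun p _ ↦ ?_
  rw [← map_primitivePart₂ φ hφ hL hvan hL' hvan' p x, ← map_primitivePart₂ φ hφ hL hvan hL' hvan' p y]
  generalize primitivePart κ n hL hvan p x = ξ
  generalize primitivePart κ n hL hvan p y = ξ'
  rcases le_or_gt p.1.1 n with ha | ha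
  · obtain ⟨s, hs⟩ : ∃ s, p.1.1 + s = n := ⟨n - p.1.1, by omega⟩
    have hm : p.1.1 + 2 * s = 2 * n - p.1.1 := by omega
    have h : (2 * n - p.1.1) + p.1.1 = 2 * n := by omega
    rw [hodgeRiemannPairing_apply τ' hs hm h, hodgeRiemannPairing_apply τ hs hm h,
      ← map_lefschetzPowTo₂ φ hφ, ← hcup, hτ]
    ring
  · simp only [hodgeRiemannPairing_of_lt τ ha, hodgeRiemannPairing_of_lt τ' ha, LinearMap.zero_apply,
      mul_zero]

end TwoSpaces

end HodgeTheory

end Literature.AlgebraicGeometry.HodgeTheory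

end
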